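import Summits.QuantumFields.YangMills.Theorems.PencilRigidityNPointIsotropyUnorderedRP
import Literature.MathematicalPhysics.QuantumLattice.SchwingerOSCluster
import Literature.MathematicalPhysics.QuantumFieldTheory.SchwingerLimitInheritance
import HarnessLib

/-!
# `MirrorModularBoosts.SoftKernelBoostCovariance`, line `Sketch`: helpers for stub (D) `stub_diagCloudGrowth`
# (the chain step in front of a cloud: linearity, locality, permutations, supports, off-diagonality)

Support file (helpers) for stub `stub_diagCloudGrowth` (D) of crux `stmt-QuantumFields-14999`
(`Summit.QuantumFields.YangMills.Theses.MirrorModularBoosts.SoftKernelBoostCovariance`), line `Sketch` (lead c13,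
skeleton v3.12).  Namespace `…SoftKernelBoostCovariance.Sketch.DiagCloud`; no `def`.

Contents (`E4 = ℝ⁴`, configurations `x : Fin n → E4`, time = coordinate `0`):
* small test-function identities (`permTest_one`, `translateMulti_permTest`, `appendTensor_permTest_right`,
  supports of finite sums, closedness of `{∀ i, t ≤ xᵢ⁰}`);
* `isOffDiagonal_appendTensor_of_separated_le`: tensors of off-diagonal functions with time-SEPARATED supports
  (`{∀ i, xᵢ⁰ ≤ t}` / `{∀ j, t < xⱼ⁰}`) are off-diagonal (threshold version of
  `UnorderedRP.isOffDiagonal_appendTensor_of_separated`);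
* `tsupport_piece_subset`: the time-ordered pieces `T_π` of a sector decomposition `∑_π (T_π)^π = c · G`
  (`UnorderedRP.exists_orderedPieces`) inherit every closed permutation-invariant support bound of `G` (the sectors
  are pairwise disjoint);
* the chain step `X ↦ τ_a (J₁ ⊗ (J₂ ⊗ τ_a X))` of the diagonal multiple-reflection chains read in the `e₀` frame:
  pointwise formula, additivity, commutation with permutations of the cloud slots (`step_permTest`), LOCALITY
  (`step_apply_of_apply_eq_mul`: a pointwise multiplier of the cloud is read off the cloud slots), and — for
  insertions with times in `[α₁, β₁]`, `(β₁, β₂]`, `β₂ < α₁ + 2a⁰` and clouds with all times `≥ α₁` — preservation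
  of the support bound "all times `≥ α₁`" (`tsupport_step_subset`) and of off-diagonality (`isOffDiagonal_step`:
  the three blocks have time-separated supports; one-slot functions are trivially off-diagonal).

References: K. Osterwalder, R. Schrader, Comm. Math. Phys. 31 (1973) §2 (`f^π`, `f_{(a,1)}`, `𝒮₊`, `𝒮_<`);
folklore.
-/

noncomputable section

namespace Summit.QuantumFields.YangMills.Theorems.SoftKernelBoostCovariance.Sketch

open scoped BigOperators SchwartzMap ComplexConjugate ContDiff
open MeasureTheory Filter Topology
open Literature.MathematicalPhysics.QuantumLattice Literature.MathematicalPhysics.AQFT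
  Literature.MathematicalPhysics.QuantumFieldTheory
open Summit.QuantumFields.YangMills.Theorems.NPointIsotropy.Negative (E4)
open Summit.QuantumFields.YangMills.Theorems.NPointIsotropy.QuarterTurnCornerOperator
open Summit.QuantumFields.YangMills.Theorems.NPointIsotropy.ComplexRotationBandlimit (Mopup.continuous_coord)

namespace DiagCloud

variable {n m : ℕ}

/-! ## Small test-function identities -/

/-- The identity permutation acts trivially on test functions. [folklore] -/
theorem permTest_one (F : 𝓢((Fin n → E4), ℂ)) : permTest (1 : Equiv.Perm (Fin n)) F = F := by
  ext x; simp [permTest_apply]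

/-- Diagonal translations commute with permutations of the arguments. [folklore] -/
theorem translateMulti_permTest (a : E4) (σ : Equiv.Perm (Fin n)) (F : 𝓢((Fin n → E4), ℂ)) :
    translateMulti a (permTest σ F) = permTest σ (translateMulti a F) := by
  ext x; simp [permTest_apply, translateMulti_apply, Function.comp_def]

/-- Permuting the second tensor factor: `A ⊗ B^τ = (A ⊗ B)^{1 ⊕ τ}`. [folklore] -/
theorem appendTensor_permTest_right (A : 𝓢((Fin n → E4), ℂ)) (τ : Equiv.Perm (Fin m))
    (B : 𝓢((Fin m → E4), ℂ)) :
    A.appendTensor (permTest τ B) =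
      permTest (finSumFinEquiv.permCongr ((1 : Equiv.Perm (Fin n)).sumCongr τ)) (A.appendTensor B) := by
  rw [← UnorderedRP.appendTensor_permTest 1 τ A B, permTest_one]

/-- The support of a finite sum of test functions lies in any set containing the supports of the summands.
[folklore] -/
theorem tsupport_sum_subset {ι : Type*} (s : Finset ι) (F : ι → 𝓢((Fin n → E4), ℂ)) {C : Set (Fin n → E4)}
    (hF : ∀ i ∈ s, tsupport ((F i : 𝓢((Fin n → E4), ℂ)) : (Fin n → E4) → ℂ) ⊆ C) :
    tsupport ((∑ i ∈ s, F i : 𝓢((Fin n → E4), ℂ)) : (Fin n → E4) → ℂ) ⊆ C := by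
  classical
  induction s using Finset.induction_on with
  | empty =>
    intro x hx
    rw [Finset.sum_empty] at hx
    have h0 : ((0 : 𝓢((Fin n → E4), ℂ)) : (Fin n → E4) → ℂ) = 0 := rfl
    rw [h0, tsupport_eq_empty_iff.mpr rfl] at hx
    exact ((Set.mem_empty_iff_false x).mp hx).elim
  | insert i s his ih =>
    rw [Finset.sum_insert his]
    exact (tsupport_add ((F i : 𝓢((Fin n → E4), ℂ)) : (Fin n → E4) → ℂ) _).trans
      (Set.union_subset (hF i (Finset.mem_insert_self i s)) (ih fun j hj => hF j (Finset.mem_insert_of_mem hj)))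

/-- The closed region `{∀ i, t ≤ xᵢ⁰}` ("all times at least `t`") is closed. [folklore] -/
theorem isClosed_setOf_forall_le (t : ℝ) : IsClosed {x : Fin n → E4 | ∀ i, t ≤ x i 0} := by
  rw [Set.setOf_forall]
  exact isClosed_iInter fun i => isClosed_le continuous_const (Mopup.continuous_coord i 0)

/-! ## Tensors with time-separated supports are off-diagonal (threshold version) -/

-- adapted from `UnorderedRP.isOffDiagonal_appendTensor_of_separated` (threshold `0` ↦ threshold `t`)
/-- **Tensors of off-diagonal functions with time-separated supports are off-diagonal**: if `A ∈ ⁰𝒮ₙ` is supported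
in `{∀ i, xᵢ⁰ ≤ t}` and `B ∈ ⁰𝒮ₘ` in `{∀ j, t < xⱼ⁰}`, then `A ⊗ B ∈ ⁰𝒮ₙ₊ₘ`. [folklore] -/
theorem isOffDiagonal_appendTensor_of_separated_le {A : 𝓢((Fin n → E4), ℂ)} {B : 𝓢((Fin m → E4), ℂ)}
    (hAo : IsOffDiagonal A) (hBo : IsOffDiagonal B) (t : ℝ)
    (hA : tsupport (A : (Fin n → E4) → ℂ) ⊆ {x | ∀ i, x i 0 ≤ t})
    (hB : tsupport (B : (Fin m → E4) → ℂ) ⊆ {x | ∀ j, t < x j 0}) :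
    IsOffDiagonal (A.appendTensor B) := by
  intro x hx k
  by_cases hxs : x ∈ tsupport ((A.appendTensor B : 𝓢((Fin (n + m) → E4), ℂ)) : (Fin (n + m) → E4) → ℂ)
  · obtain ⟨h1, h2⟩ := OSReconstructionNoE1.tsupport_appendTensor_subset A B hxs
    have hneg : ∀ i, x (Fin.castAdd m i) 0 ≤ t := hA h1
    have hpos : ∀ j, t < x (Fin.natAdd n j) 0 := hB h2
    set L₁ : (Fin (n + m) → E4) →L[ℝ] (Fin n → E4) := SchwartzMap.restrictCLM (Fin.castAdd m) with hL₁
    set L₂ : (Fin (n + m) → E4) →L[ℝ] (Fin m → E4) := SchwartzMap.restrictCLM (Fin.natAdd n) with hL₂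
    have hfun : ((A.appendTensor B : 𝓢((Fin (n + m) → E4), ℂ)) : (Fin (n + m) → E4) → ℂ) =
        fun y => ((A : (Fin n → E4) → ℂ) ∘ L₁) y * ((B : (Fin m → E4) → ℂ) ∘ L₂) y := rfl
    have hAs : ContDiff ℝ ∞ ((A : (Fin n → E4) → ℂ) ∘ L₁) := (A.smooth ⊤).comp L₁.contDiff
    have hBs : ContDiff ℝ ∞ ((B : (Fin m → E4) → ℂ) ∘ L₂) := (B.smooth ⊤).comp L₂.contDiff
    obtain ⟨p, q, hpq, hxpq⟩ := hx
    have ht : x p 0 = x q 0 := by rw [hxpq]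
    rw [hfun]
    induction p using Fin.addCases with
    | left i =>
      induction q using Fin.addCases with
      | left j =>
        refine UnorderedRP.iteratedFDeriv_mul_eq_zero_of_left hAs hBs
          (UnorderedRP.iteratedFDeriv_comp_clm_eq_zero _ (A.smooth ⊤) (fun k' => hAo _ ?_ k')) k
        exact ⟨i, j, fun h => hpq (by rw [h]), hxpq⟩
      | right j =>
        exfalso
        linarith [hneg i, hpos j]
    | right i =>
      induction q using Fin.addCases with
      | left j =>
        exfalso
        linarith [hpos i, hneg j]
      | right j =>
        refine UnorderedRP.iteratedFDeriv_mul_eq_zero_of_right hAs hBs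
          (UnorderedRP.iteratedFDeriv_comp_clm_eq_zero _ (B.smooth ⊤) (fun k' => hBo _ ?_ k')) k
        exact ⟨i, j, fun h => hpq (by rw [h]), hxpq⟩
  · by_contra hne
    exact hxs (support_iteratedFDeriv_subset k (Function.mem_support.mpr hne))

/-! ## Supports of the time-ordered pieces of the sector decomposition -/

/-- **The sector pieces inherit permutation-invariant closed support bounds.** If `∑_π (T_π)^π = c · G` pointwise
with every `T_π` time-ordered, then each `T_π` is supported in every closed, permutation-invariant set containing the
support of `G`: the sectors are pairwise disjoint, so at a point where `T_π` does not vanish the whole sum is that one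
term, whence `G ≠ 0` there (up to the permutation). [folklore] -/
theorem tsupport_piece_subset {G : 𝓢((Fin n → E4), ℂ)} {T : Equiv.Perm (Fin n) → 𝓢((Fin n → E4), ℂ)}
    {c : (Fin n → E4) → ℝ} (hT : ∀ π, IsTimeOrdered (T π))
    (hsum : ∀ x, (∑ π, permTest π (T π)) x = (c x : ℂ) * G x)
    {C : Set (Fin n → E4)} (hC : IsClosed C) (hCperm : ∀ (x : Fin n → E4) (σ : Equiv.Perm (Fin n)), x ∈ C → x ∘ ⇑σ ∈ C)
    (hG : tsupport (G : (Fin n → E4) → ℂ) ⊆ C) (π : Equiv.Perm (Fin n)) :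
    tsupport ((T π : 𝓢((Fin n → E4), ℂ)) : (Fin n → E4) → ℂ) ⊆ C := by
  refine closure_minimal (fun x hx => ?_) hC
  rw [Function.mem_support] at hx
  have hxord : StrictMono fun i => x i 0 := (hT π (subset_closure (Function.mem_support.2 hx))).2
  set y : Fin n → E4 := x ∘ ⇑π.symm with hy
  have hyx : y ∘ ⇑π = x := by
    funext i
    simp [hy]
  have hyinj : Function.Injective fun i => y i 0 :=
    hxord.injective.comp π.symm.injective
  have hπ : π = Tuple.sort fun i => y i 0 :=
    (UnorderedRP.strictMono_iff_eq_sort hyinj π).1 (by simpa [hy] using hxord)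
  have hvan : ∀ π', π' ≠ π → permTest π' (T π') y = 0 := by
    intro π' hne
    by_contra h0
    rw [permTest_apply] at h0
    have hord' : StrictMono fun i => (y ∘ ⇑π') i 0 := (hT π' (subset_closure (Function.mem_support.2 h0))).2
    exact hne (((UnorderedRP.strictMono_iff_eq_sort hyinj π').1 hord').trans hπ.symm)
  have hsum_y : (∑ π', permTest π' (T π')) y = T π x := by
    rw [sum_apply, Finset.sum_eq_single π (fun π' _ hne => hvan π' hne) (fun h => absurd (Finset.mem_univ π) h),
      permTest_apply, hyx]
  have hGy : G y ≠ 0 := by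
    intro h0
    rw [hsum, h0, mul_zero] at hsum_y
    exact hx hsum_y.symm
  have hyC : y ∈ C := hG (subset_closure (Function.mem_support.2 hGy))
  simpa [hyx] using hCperm y π hyC

/-! ## The chain step `X ↦ τ_a (J₁ ⊗ (J₂ ⊗ τ_a X))`: pointwise formula, linearity, permutations, supports -/

section Step

variable (a : E4) (J₁ J₂ : 𝓢((Fin 1 → E4), ℂ))

/-- Pointwise formula for the chain step: `τ_a (J₁ ⊗ (J₂ ⊗ τ_a X)) (y) = J₁(y₀ - a) · J₂(y₁ - a) · X(y_cloud - 2a)`.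
[folklore] -/
theorem step_apply (X : 𝓢((Fin m → E4), ℂ)) (y : Fin (1 + (1 + m)) → E4) :
    translateMulti a (J₁.appendTensor (J₂.appendTensor (translateMulti a X))) y =
      J₁ (fun i => y (Fin.castAdd (1 + m) i) - a) *
        (J₂ (fun i => y (Fin.natAdd 1 (Fin.castAdd m i)) - a) *
          X (fun j => y (Fin.natAdd 1 (Fin.natAdd 1 j)) - a - a)) := by
  simp only [translateMulti_apply, SchwartzMap.appendTensor_apply]
  rfl

/-- The chain step is additive over finite sums of clouds. [folklore] -/
theorem step_sum {ι : Type*} (s : Finset ι) (X : ι → 𝓢((Fin m → E4), ℂ)) :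
    translateMulti a (J₁.appendTensor (J₂.appendTensor (translateMulti a (∑ i ∈ s, X i)))) =
      ∑ i ∈ s, translateMulti a (J₁.appendTensor (J₂.appendTensor (translateMulti a (X i)))) := by
  rw [map_sum, SchwartzMap.appendTensor_sum_right, SchwartzMap.appendTensor_sum_right, map_sum]

/-- The chain step commutes with permutations of the cloud slots: `P(X^π) = (P X)^{1 ⊕ (1 ⊕ π)}`. [folklore] -/
theorem step_permTest (π : Equiv.Perm (Fin m)) (X : 𝓢((Fin m → E4), ℂ)) :
    translateMulti a (J₁.appendTensor (J₂.appendTensor (translateMulti a (permTest π X)))) =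
      permTest (finSumFinEquiv.permCongr ((1 : Equiv.Perm (Fin 1)).sumCongr
        (finSumFinEquiv.permCongr ((1 : Equiv.Perm (Fin 1)).sumCongr π))))
        (translateMulti a (J₁.appendTensor (J₂.appendTensor (translateMulti a X)))) := by
  rw [translateMulti_permTest, appendTensor_permTest_right, appendTensor_permTest_right, translateMulti_permTest]

/-- The chain step is LOCAL in the cloud: a pointwise multiplier of the cloud becomes a pointwise multiplier (read off
the cloud slots, shifted back by `2a`) of the chain step. [folklore] -/
theorem step_apply_of_apply_eq_mul {X Y : 𝓢((Fin m → E4), ℂ)} {c : (Fin m → E4) → ℝ}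
    (hY : ∀ x, Y x = (c x : ℂ) * X x) (y : Fin (1 + (1 + m)) → E4) :
    translateMulti a (J₁.appendTensor (J₂.appendTensor (translateMulti a Y))) y =
      (c (fun j => y (Fin.natAdd 1 (Fin.natAdd 1 j)) - a - a) : ℂ) *
        translateMulti a (J₁.appendTensor (J₂.appendTensor (translateMulti a X))) y := by
  rw [step_apply, step_apply, hY]
  ring

/-- Reading the cloud slots (shifted back by `2a`) preserves "pairwise distinct times". [folklore] -/
theorem injective_cloud {y : Fin (1 + (1 + m)) → E4} (hy : Function.Injective fun i => y i 0) :
    Function.Injective fun j : Fin m => (fun j => y (Fin.natAdd 1 (Fin.natAdd 1 j)) - a - a) j 0 := by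
  intro j j' hjj'
  have h : y (Fin.natAdd 1 (Fin.natAdd 1 j)) 0 = y (Fin.natAdd 1 (Fin.natAdd 1 j')) 0 := by
    simpa [sub_left_inj] using hjj'
  exact Fin.natAdd_injective _ _ (Fin.natAdd_injective _ _ (hy h))

variable {a J₁ J₂}
variable {α₁ β₁ β₂ : ℝ}

/-- The twice-translated cloud has all times `> β₂`. [folklore] -/
theorem tsupport_cloud_subset (hβ₂ : β₂ < α₁ + 2 * a 0) {X : 𝓢((Fin m → E4), ℂ)}
    (hXs : tsupport (X : (Fin m → E4) → ℂ) ⊆ {x | ∀ i, α₁ ≤ x i 0}) :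
    tsupport ((translateMulti a (translateMulti a X) : 𝓢((Fin m → E4), ℂ)) : (Fin m → E4) → ℂ) ⊆
      {x | ∀ j, β₂ < x j 0} := by
  intro x hx j
  have h1 := tsupport_translateMulti_subset a _ hx
  have h2 := tsupport_translateMulti_subset a _ h1
  have h3 := hXs h2 j
  simp only [PiLp.sub_apply] at h3
  linarith

/-- The inner block `τ_a J₂ ⊗ τ_{2a} X` of the chain step has all times `> β₁`. [folklore] -/
theorem tsupport_inner_subset (hβ : β₁ < β₂) (hβ₂ : β₂ < α₁ + 2 * a 0)
    (hJ₂ : tsupport (translateMulti a J₂ : (Fin 1 → E4) → ℂ) ⊆ {x | β₁ < x 0 0 ∧ x 0 0 ≤ β₂})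
    {X : 𝓢((Fin m → E4), ℂ)} (hXs : tsupport (X : (Fin m → E4) → ℂ) ⊆ {x | ∀ i, α₁ ≤ x i 0}) :
    tsupport (((translateMulti a J₂).appendTensor (translateMulti a (translateMulti a X)) :
        𝓢((Fin (1 + m) → E4), ℂ)) : (Fin (1 + m) → E4) → ℂ) ⊆ {x | ∀ j, β₁ < x j 0} := by
  intro x hx j
  obtain ⟨h2, h3⟩ := OSReconstructionNoE1.tsupport_appendTensor_subset _ _ hx
  induction j using Fin.addCases with
  | left i =>
    have h := (hJ₂ h2).1
    rw [Subsingleton.elim i 0]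
    exact h
  | right j =>
    have h := tsupport_cloud_subset hβ₂ hXs h3 j
    dsimp only at h
    linarith

/-- **The chain step preserves the support bound "all times `≥ α₁`".** [folklore] -/
theorem tsupport_step_subset (hαβ : α₁ ≤ β₁) (hβ : β₁ < β₂) (hβ₂ : β₂ < α₁ + 2 * a 0)
    (hJ₁ : tsupport (translateMulti a J₁ : (Fin 1 → E4) → ℂ) ⊆ {x | α₁ ≤ x 0 0 ∧ x 0 0 ≤ β₁})
    (hJ₂ : tsupport (translateMulti a J₂ : (Fin 1 → E4) → ℂ) ⊆ {x | β₁ < x 0 0 ∧ x 0 0 ≤ β₂})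
    {X : 𝓢((Fin m → E4), ℂ)} (hXs : tsupport (X : (Fin m → E4) → ℂ) ⊆ {x | ∀ i, α₁ ≤ x i 0}) :
    tsupport ((translateMulti a (J₁.appendTensor (J₂.appendTensor (translateMulti a X))) :
        𝓢((Fin (1 + (1 + m)) → E4), ℂ)) : (Fin (1 + (1 + m)) → E4) → ℂ) ⊆ {y | ∀ i, α₁ ≤ y i 0} := by
  rw [translateMulti_appendTensor, translateMulti_appendTensor]
  intro y hy i
  obtain ⟨h1, h23⟩ := OSReconstructionNoE1.tsupport_appendTensor_subset _ _ hy
  induction i using Fin.addCases with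
  | left i =>
    have h := (hJ₁ h1).1
    rw [Subsingleton.elim i 0]
    exact h
  | right j =>
    have h := tsupport_inner_subset hβ hβ₂ hJ₂ hXs h23 j
    dsimp only at h
    linarith

/-- **The chain step preserves off-diagonality** (for clouds with all times `≥ α₁`): the blocks `τ_a J₁` (times
`≤ β₁`), `τ_a J₂` (times in `(β₁, β₂]`) and `τ_{2a} X` (times `> β₂`) have time-separated supports, and one-slot
functions are trivially off-diagonal. [folklore] -/
theorem isOffDiagonal_step (hβ : β₁ < β₂) (hβ₂ : β₂ < α₁ + 2 * a 0)
    (hJ₁ : tsupport (translateMulti a J₁ : (Fin 1 → E4) → ℂ) ⊆ {x | α₁ ≤ x 0 0 ∧ x 0 0 ≤ β₁})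
    (hJ₂ : tsupport (translateMulti a J₂ : (Fin 1 → E4) → ℂ) ⊆ {x | β₁ < x 0 0 ∧ x 0 0 ≤ β₂})
    {X : 𝓢((Fin m → E4), ℂ)} (hXo : IsOffDiagonal X)
    (hXs : tsupport (X : (Fin m → E4) → ℂ) ⊆ {x | ∀ i, α₁ ≤ x i 0}) :
    IsOffDiagonal (translateMulti a (J₁.appendTensor (J₂.appendTensor (translateMulti a X)))) := by
  rw [translateMulti_appendTensor, translateMulti_appendTensor]
  have hA₁ : tsupport (translateMulti a J₁ : (Fin 1 → E4) → ℂ) ⊆ {x | ∀ i, x i 0 ≤ β₁} := by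
    intro x hx i
    rw [Subsingleton.elim i 0]
    exact (hJ₁ hx).2
  have hA₂ : tsupport (translateMulti a J₂ : (Fin 1 → E4) → ℂ) ⊆ {x | ∀ i, x i 0 ≤ β₂} := by
    intro x hx i
    rw [Subsingleton.elim i 0]
    exact (hJ₂ hx).2
  have h23 : IsOffDiagonal ((translateMulti a J₂).appendTensor (translateMulti a (translateMulti a X))) :=
    isOffDiagonal_appendTensor_of_separated_le (isOffDiagonal_of_subsingleton _)
      ((hXo.translateMulti a).translateMulti a) β₂ hA₂ (tsupport_cloud_subset hβ₂ hXs)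
  exact isOffDiagonal_appendTensor_of_separated_le (isOffDiagonal_of_subsingleton _) h23 β₁ hA₁
    (tsupport_inner_subset hβ hβ₂ hJ₂ hXs)

end Step

end DiagCloud

/-- **Registered helper package `stub_diagCloudGrowthHelpers` of stub (D) `stub_diagCloudGrowth`** (line `Sketch`):
for the chain step `X ↦ τ_a (J₁ ⊗ (J₂ ⊗ τ_a X))` with translated insertions in the time windows `[α₁, β₁]`,
`(β₁, β₂]`, `β₂ < α₁ + 2a⁰`, and a cloud `X` with all times `≥ α₁`: the step keeps all times `≥ α₁`, preserves
off-diagonality, commutes with permutations of the cloud slots, and is local in the cloud (a pointwise multiplier of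
the cloud is read off the cloud slots).  The conjunction of `DiagCloud.tsupport_step_subset`,
`DiagCloud.isOffDiagonal_step`, `DiagCloud.step_permTest`, `DiagCloud.step_apply_of_apply_eq_mul`. [folklore] -/
theorem stub_diagCloudGrowthHelpers :
    open Literature.MathematicalPhysics.QuantumLattice Literature.MathematicalPhysics.AQFT
      Literature.MathematicalPhysics.QuantumFieldTheory
      Summit.QuantumFields.YangMills.Theorems.NPointIsotropy.Negative in
    ∀ (a : E4) (J₁ J₂ : SchwartzMap (Fin 1 → E4) ℂ) (α₁ β₁ β₂ : ℝ),
      α₁ ≤ β₁ → β₁ < β₂ → β₂ < α₁ + 2 * a 0 →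
      tsupport (translateMulti a J₁ : (Fin 1 → E4) → ℂ) ⊆ {x | α₁ ≤ x 0 0 ∧ x 0 0 ≤ β₁} →
      tsupport (translateMulti a J₂ : (Fin 1 → E4) → ℂ) ⊆ {x | β₁ < x 0 0 ∧ x 0 0 ≤ β₂} →
    ∀ (m : ℕ) (X : SchwartzMap (Fin m → E4) ℂ),
      tsupport (X : (Fin m → E4) → ℂ) ⊆ {x | ∀ i, α₁ ≤ x i 0} →
      tsupport (translateMulti a (J₁.appendTensor (J₂.appendTensor (translateMulti a X))) :
          (Fin (1 + (1 + m)) → E4) → ℂ) ⊆ {y | ∀ i, α₁ ≤ y i 0} ∧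
      (IsOffDiagonal X →
        IsOffDiagonal (translateMulti a (J₁.appendTensor (J₂.appendTensor (translateMulti a X))))) ∧
      (∀ π : Equiv.Perm (Fin m),
        translateMulti a (J₁.appendTensor (J₂.appendTensor (translateMulti a (permTest π X)))) =
          permTest (finSumFinEquiv.permCongr ((1 : Equiv.Perm (Fin 1)).sumCongr
            (finSumFinEquiv.permCongr ((1 : Equiv.Perm (Fin 1)).sumCongr π))))
            (translateMulti a (J₁.appendTensor (J₂.appendTensor (translateMulti a X))))) ∧
      (∀ (Y : SchwartzMap (Fin m → E4) ℂ) (c : (Fin m → E4) → ℝ), (∀ x, Y x = (c x : ℂ) * X x) →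
        ∀ y, translateMulti a (J₁.appendTensor (J₂.appendTensor (translateMulti a Y))) y =
          (c (fun j => y (Fin.natAdd 1 (Fin.natAdd 1 j)) - a - a) : ℂ) *
            translateMulti a (J₁.appendTensor (J₂.appendTensor (translateMulti a X))) y) := by
  intro a J₁ J₂ α₁ β₁ β₂ hαβ hβ hβ₂ hJ₁ hJ₂ m X hXs
  exact ⟨DiagCloud.tsupport_step_subset hαβ hβ hβ₂ hJ₁ hJ₂ hXs,
    fun hXo => DiagCloud.isOffDiagonal_step hβ hβ₂ hJ₁ hJ₂ hXo hXs,
    fun π => DiagCloud.step_permTest a J₁ J₂ π X,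
    fun Y c hY y => DiagCloud.step_apply_of_apply_eq_mul a J₁ J₂ hY y⟩

end Summit.QuantumFields.YangMills.Theorems.SoftKernelBoostCovariance.Sketch

end
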